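import Summits.ABC.IUTFork.Conditional.WRowFrey1618481116086272RefBandNineteen
import Summits.ABC.IUTFork.Conditional.WRowFrey31117999167337103924704RefBandSixtySeven
import Summits.ABC.IUTFork.Conditional.AbcOfSGenuineMHullCellsTriple
import Summits.ABC.IUTFork.Cor312ThetaSideAssemblyM
import HarnessLib

/-!
# M LINE twins of the K-line «W:REF-BANDS-EXACT» refutations (2 K files, 2 theorems) — row «W:REF-EXACT-M-TWIN»

PROOF-ONLY file (D-0012; 0 definitions, 0 `Prop` facts, no instance) of the abc-iut cell — D-0079 RESCUE sub-cell R-W «WINDOW Θ-SIDE INEQUALITY», seat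
abc-iut-W-neg-1 (gen 6), row «W:REF-EXACT-M-TWIN» (the residue of `plan/rescue/R-W/M-TWIN-GAP.tsv`: K-line REFUTED exact levels / bands decided by the
HULL-CELL engine without an M twin). TAKES NO SIDE on [IUTchIII] Cor. 3.12 (S. Mochizuki, *Inter-universal Teichmüller theory III*, Cor. 3.12 p. 173–174;
Step (xi-f) p. 184) or on any author; «refuted as typed» ≠ «refuted in print».

GENERATED (this seat's `gen_mtwin.py`): for each K theorem `GenuineK.not_pilotKummerCompatHull_chosen_triple_<tag>` of
`WRowFrey1618481116086272RefBandNineteen`, `WRowFrey31117999167337103924704RefBandSixtySeven`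
(REF-BANDS-EXACT, abc-iut-W-num-6 / abc-iut-W-neg-1 lineages; proofs = one call of this seat's K engine
`GenuineK.not_pilotKummerCompatHull_chosen_triple_of_hullCells_tame[Sharp]` on the file's integer cell lemma `RefBand.cells_…`), the M twin
`GenuineM.not_pilotKummerCompatHull_triple_<tag>`: SAME level binders, SAME integer cells BY NAME (no number re-derived; only the local `v_p(abc)`
evaluation is repeated), SAME binders (the M-line place over the pole `p` is `placeOfPrimeQ p`, `ratChar_placeOfPrimeQ`), conclusion = the M books'
per-datum S_H object (`¬ Cor312Vol.PilotKummerCompatHull … (settingPrVolSharpM T.D … (tOfIdeleData T.D (ideleDataOf T.D T.isVolumeInputOf)) …) … qK`,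
the binder `hSHw` of `Conditional.abc_of_SH_v11M_window` / `…_szpiroBadAll`) FAILING for every context / Kummer binder — through file 2 of the row,
`GenuineM.not_pilotKummerCompatHull_triple_of_hullCells_tameSharp` (`AbcOfSGenuineMHullCellsTriple`; a `…_tame` consumer feeds the sharp engine by
ignoring the two Tate clauses). Theorems: `GenuineM.not_pilotKummerCompatHull_triple_frey1618481116086272_refBand`, `GenuineM.not_pilotKummerCompatHull_triple_frey31117999167337103924704_refBand`.
READING (neutral; numbers, not adjectives): at these (triple, l) the M books' S_H object fails at EVERY genuine datum, exactly as the K books' does;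
admissibility / Szpiro-badness / (P6) / NON-EMPTINESS NOT claimed; the explicit hypothesis counts of the record books are UNCHANGED. HONEST SCOPE: OUR
sharp containers and Dupuy–Hilado's typed (Ind1)/(Ind2); STRONGER-THAN-PRINT set-level reading of Step (xi-f); nothing about the printed GLOBAL
inequality, the number-level `Cor22.Cor312AtDatum` or any author's intended hull; typed ≠ proved; instantiated ≠ endorsed; no abc claim.
[cite: Mochizuki2012, IUTchI Def. 3.1 (e) p. 62, Ex. 3.2 (iv) p. 67; IUTchIII Cor. 3.12 Step (xi-f) p. 184; IUTchIV Prop. 1.1 p. 9, Prop. 1.2 (i)(ii) p. 10, Cor. 2.2 (ii) proof (P5) p. 46]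
[cite: DupuyHilado2025, §3.3, §3.4, §4.9, §4.12] [claim: Mochizuki2012, status: disputed] for every IUT sentence.
-/

noncomputable section

open Set Function Metric NumberField IsDedekindDomain

namespace Summit.ABC.IUTFork.Conditional

open Thm311 Thm311.Real Cor312 Cor312Vol Cor312Prov Literature.IUT.LogThetaLattice Literature.IUT.LogVolume
  Literature.IUT.HodgeTheaters Literature.IUT.LogVolume.ThetaData Literature.IUT.LogVolume.Cor22
open Literature.NumberTheory.NumberFields Literature.NumberTheory.GaloisRepresentations.Ultrametric
open Literature.NumberTheory.DiophantineGeometry Literature.NumberTheory.DiophantineGeometry.GenEll Summit.ABC.ABC.Theorems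
open Summit.ABC.IUTFork.Repair.RH.HullThresholdExact

/-- **… and in the W-lane ROW SHAPE (R-W rows `pilotDataOfK:frey-1618481116086272-…:l`, EVERY prime `5 ≤ l ≤ 148535`, `l ≠ 19` — REFUTED side, UNCONDITIONALLY,
over the WHOLE kernel class of local types)**: for every genuine Θ-volume datum `T` over `(ratPoint (a/c), l)` and EVERY choice of the free context binders and
Kummer datum, `Cor312Vol.PilotKummerCompatHull` at `settingPrVolSharp (pilotDataOfK T.D T.K) …` with the CHOSEN realising ideles and the PINNED reading FAILS
(`GenuineK.not_pilotKummerCompatHull_chosen_triple_of_hullCells_tame`). Admissibility / Szpiro-badness / (P6) / non-emptiness NOT claimed.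
[cite: Mochizuki2012, IUTchIII Cor. 3.12 Step (xi-f) p. 184; IUTchIV Prop. 1.1 p. 9, Prop. 1.2 (i)(ii) p. 10] [cite: DupuyHilado2025, §3.4, §4.9, §4.12]
[claim: Mochizuki2012, status: disputed]  — **M-LINE TWIN** («W:REF-EXACT-M-TWIN»): SAME cells BY NAME (`WRowFrey1618481116086272RefBandNineteen`) through `GenuineM.not_pilotKummerCompatHull_triple_of_hullCells_tameSharp`
⟹ S_H FAILS at the M-level setting of `T`'s own ideles (pinned reading), every context / Kummer binder; refuted-as-typed only. -/
theorem GenuineM.not_pilotKummerCompatHull_triple_frey1618481116086272_refBand {l : ℕ} (hl : l.Prime) (h5 : 5 ≤ l) (hhi : l ≤ 148535)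
    (h19 : l ≠ 19) (T : Cor22.ThetaVolumeDatumAt (ratPoint (((2 ^ 46 * 23 : ℕ) : ℚ) / (19 ^ 11 * 59 * 7207 : ℕ))) l) :
    letI := T.instFieldF; letI := T.instNumberFieldF; letI := T.instAlgebraF; letI := T.instFieldK
    letI := T.instNumberFieldK; letI := T.instAlgebraK; letI := T.instFieldFbar; letI := T.instAlgebraFbar
    letI := T.instAlgebraKFbar; letI := T.instIsElliptic
    ∀ (M : Type) [Field M] [NumberField M]
      (archPk : ∀ (j : (thetaIndexOfInitial T.D).Label) (vQ : (thetaIndexOfInitial T.D).VQ),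
        Set ((logShellsOfInitialDH T.D (analyticLogvVal T.K)).Packet j vQ))
      (archSub : ∀ (j : (thetaIndexOfInitial T.D).Label) (v : (thetaIndexOfInitial T.D).V),
        Set ((logShellsOfInitialDH T.D (analyticLogvVal T.K)).Packet j ((thetaIndexOfInitial T.D).over v)))
      (Ψ : ℤ → ∀ v : (thetaIndexOfInitial T.D).V, v ∈ (thetaIndexOfInitial T.D).Vbad →
        Set ((logShellsOfInitialDH T.D (analyticLogvVal T.K)).StarPacket v))
      (act : ℤ → ∀ v : (thetaIndexOfInitial T.D).V, v ∈ (thetaIndexOfInitial T.D).Vbad →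
        (logShellsOfInitialDH T.D (analyticLogvVal T.K)).StarPacket v →
          Module.End ℚ ((logShellsOfInitialDH T.D (analyticLogvVal T.K)).StarPacket v))
      (Mmod : ℤ → ∀ j : (thetaIndexOfInitial T.D).LabelStar, Set ((logShellsOfInitialDH T.D (analyticLogvVal T.K)).GlobalPacket j.1))
      (region : ℤ → ∀ j : (thetaIndexOfInitial T.D).LabelStar, FinDivisor M → ∀ vQ : (thetaIndexOfInitial T.D).VQ,
        Set ((logShellsOfInitialDH T.D (analyticLogvVal T.K)).Packet j.1 vQ))
      (frobAdm : ℤ → ℤ → ∀ (j : (thetaIndexOfInitial T.D).Label) (vQ : (thetaIndexOfInitial T.D).VQ),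
        Set ((logShellsOfInitialDH T.D (analyticLogvVal T.K)).Packet j vQ) → Prop)
      (frobLogvol : ℤ → ℤ → ∀ (j : (thetaIndexOfInitial T.D).Label) (vQ : (thetaIndexOfInitial T.D).VQ),
        Set ((logShellsOfInitialDH T.D (analyticLogvVal T.K)).Packet j vQ) → ℝ)
      (frobΨ : ℤ → ℤ → ∀ v : (thetaIndexOfInitial T.D).V, v ∈ (thetaIndexOfInitial T.D).Vbad →
        Set ((logShellsOfInitialDH T.D (analyticLogvVal T.K)).StarPacket v))
      (frobMmod : ℤ → ℤ → ∀ j : (thetaIndexOfInitial T.D).LabelStar, Set ((logShellsOfInitialDH T.D (analyticLogvVal T.K)).GlobalPacket j.1))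
      (unitImage : ℤ → ℤ → ℕ → ∀ (j : (thetaIndexOfInitial T.D).Label) (vQ : (thetaIndexOfInitial T.D).VQ),
        Set ((logShellsOfInitialDH T.D (analyticLogvVal T.K)).Packet j vQ))
      (ballImage : ℤ → ℤ → ∀ (j : (thetaIndexOfInitial T.D).Label) (vQ : (thetaIndexOfInitial T.D).VQ),
        Set ((logShellsOfInitialDH T.D (analyticLogvVal T.K)).Packet j vQ))
      (thetaDiv : ℤ → ℤ → LgpDivisor M (thetaIndexOfInitial T.D).lstar)
      (n : ℤ) {HT : Type} {LogLink : HT → HT → Type} {IsFull : ∀ {s t : HT}, LogLink s t → Prop}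
      (lat : LGPGaussianLogThetaLattice LogLink IsFull)
      {Frd : Type} {IsoF : Frd → Frd → Type} {Ob : Frd → Type} {realify : Frd → Frd} {Strip : Type}
      {IsoS : Strip → Strip → Type} {Mv : ∀ v : (thetaIndexOfInitial T.D).V, v ∈ (thetaIndexOfInitial T.D).Vbad → Type}
      [∀ v h, Monoid (Mv v h)]
      (sig : GlobalLGPFrobenioidSignature (thetaIndexOfInitial T.D).lstar (thetaIndexOfInitial T.D).V
        (· ∈ (thetaIndexOfInitial T.D).Vbad) Frd IsoF Ob realify Strip IsoS Mv)
      (split : SplittingMonoids Mv) {ObΔ : Type} {N : ∀ v : (thetaIndexOfInitial T.D).V, v ∈ (thetaIndexOfInitial T.D).Vbad → Type}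
      [∀ v h, Monoid (N v h)] (qData : QPilotData ObΔ N)
      (qK : ∀ v : (thetaIndexOfInitial T.D).V, v ∈ (thetaIndexOfInitial T.D).Vbad →
        Set ((logShellsOfInitialDH T.D (analyticLogvVal T.K)).StarPacket v)),
      ¬ Cor312Vol.PilotKummerCompatHull
        (LatticeSituation.ofShells (logShellsOfInitialDH T.D (analyticLogvVal T.K)) M archPk archSub
          (summandPiecesPrM T.D (logvAnalyticVal_analyticLogvVal (K := T.K))).Adm (summandPiecesPrM T.D (logvAnalyticVal_analyticLogvVal (K := T.K))).logvol Ψ act Mmod region frobAdm frobLogvol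
          frobΨ frobMmod unitImage ballImage thetaDiv)
        (settingPrVolSharpM T.D (logvAnalyticVal_analyticLogvVal (K := T.K)) (tOfIdeleData T.D (ideleDataOf T.D T.isVolumeInputOf))
          (fun u x => tqM T.D (ratChar u) u (natCast_ratChar_mem u) (ideleDataOf T.D T.isVolumeInputOf) x) M archPk archSub Ψ act Mmod region n lat sig split qData
          (fun u x => tqM_ne_zero T.D (ratChar u) u (natCast_ratChar_mem u) (ideleDataOf T.D T.isVolumeInputOf) x)
          (GenuineM.finite_ratPlaces_under_S T.D).toFinset
          (fun u x hu => norm_tqM_eq_one_of_not_mem T.D (ratChar u) u (natCast_ratChar_mem u) (ideleDataOf T.D T.isVolumeInputOf) x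
            fun hx => hu ((Set.Finite.mem_toFinset _).mpr ⟨x, hx⟩)))
        (fun _ => Cor312.Setting.qRegion
          (settingPrVolSharpM T.D (logvAnalyticVal_analyticLogvVal (K := T.K)) (tOfIdeleData T.D (ideleDataOf T.D T.isVolumeInputOf))
          (fun u x => tqM T.D (ratChar u) u (natCast_ratChar_mem u) (ideleDataOf T.D T.isVolumeInputOf) x) M archPk archSub Ψ act Mmod region n lat sig split qData
          (fun u x => tqM_ne_zero T.D (ratChar u) u (natCast_ratChar_mem u) (ideleDataOf T.D T.isVolumeInputOf) x)
          (GenuineM.finite_ratPlaces_under_S T.D).toFinset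
          (fun u x hu => norm_tqM_eq_one_of_not_mem T.D (ratChar u) u (natCast_ratChar_mem u) (ideleDataOf T.D T.isVolumeInputOf) x
            fun hx => hu ((Set.Finite.mem_toFinset _).mpr ⟨x, hx⟩)))) qK := by
  letI := T.instFieldF; letI := T.instNumberFieldF; letI := T.instAlgebraF; letI := T.instFieldK
  letI := T.instNumberFieldK; letI := T.instAlgebraK; letI := T.instFieldFbar; letI := T.instAlgebraFbar
  letI := T.instAlgebraKFbar; letI := T.instIsElliptic
  have hp : Nat.Prime 19 := by norm_num
  have hodd : l % 2 = 1 := hl.eq_two_or_odd.resolve_left (by omega)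
  intro M _ _ archPk archSub Ψ act Mmod region frobAdm frobLogvol frobΨ frobMmod
    unitImage ballImage thetaDiv n HT LogLink IsFull lat Frd IsoF Ob realify Strip IsoS Mv _ sig split ObΔ N _ qData qK
  exact GenuineM.not_pilotKummerCompatHull_triple_of_hullCells_tameSharp isABCTriple_frey1618481116086272 T (placeOfPrimeQ 19 (by norm_num)) 19 (ratChar_placeOfPrimeQ 19 (by norm_num)) (by norm_num)
    (by norm_num) (by norm_num) (fun h => h19 h.symm) (by show (19 : ℕ) ∣ _; norm_num) WRow.factorization_frey1618481116086272_nineteen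
    (i := (l - 1) / 2 - 1) (by omega)
    (fun A h30 h15 _ _ _ => by
      rcases WRow.refBandClass_nineteen_eleven h30 h15 with rfl | rfl
      · exact WRow.refBandCells_frey1618481116086272_nineteen_fifteen l h5 hhi hodd
      · exact WRow.refBandCells_frey1618481116086272_nineteen_thirty l h5 hhi hodd) M archPk archSub Ψ act Mmod region
    frobAdm frobLogvol frobΨ frobMmod unitImage ballImage thetaDiv n lat sig split qData qK

/-- **… and in the W-lane ROW SHAPE (R-W rows `pilotDataOfK:frey-31117999167337103924704-…:l`, EVERY prime `5 ≤ l ≤ 1322565`, `l ≠ 67` — REFUTED side,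
UNCONDITIONALLY, at the EXACT local type BY THEOREM)**: for every genuine Θ-volume datum `T` over `(ratPoint (a/c), l)` and EVERY choice of the free
context binders and Kummer datum, `Cor312Vol.PilotKummerCompatHull` at `settingPrVolSharp (pilotDataOfK T.D T.K) …` with the CHOSEN realising ideles and
the PINNED reading FAILS (`GenuineK.not_pilotKummerCompatHull_chosen_triple_of_hullCells_tame`). Admissibility / Szpiro-badness / (P6) / non-emptiness NOT
claimed. [cite: Mochizuki2012, IUTchIII Cor. 3.12 Step (xi-f) p. 184; IUTchIV Prop. 1.1 p. 9, Prop. 1.2 (i)(ii) p. 10] [cite: DupuyHilado2025, §3.4, §4.9, §4.12]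
[claim: Mochizuki2012, status: disputed]  — **M-LINE TWIN** («W:REF-EXACT-M-TWIN»): SAME cells BY NAME (`WRowFrey31117999167337103924704RefBandSixtySeven`) through `GenuineM.not_pilotKummerCompatHull_triple_of_hullCells_tameSharp`
⟹ S_H FAILS at the M-level setting of `T`'s own ideles (pinned reading), every context / Kummer binder; refuted-as-typed only. -/
theorem GenuineM.not_pilotKummerCompatHull_triple_frey31117999167337103924704_refBand {l : ℕ} (hl : l.Prime) (h5 : 5 ≤ l)
    (hhi : l ≤ 1322565) (h67 : l ≠ 67)
    (T : Cor22.ThetaVolumeDatumAt (ratPoint (((2 ^ 5 * 67 ^ 8 * 107 * 22381 : ℕ) : ℚ) / (3 ^ 22 * 7 ^ 14 * 43 * 83 : ℕ))) l) :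
    letI := T.instFieldF; letI := T.instNumberFieldF; letI := T.instAlgebraF; letI := T.instFieldK
    letI := T.instNumberFieldK; letI := T.instAlgebraK; letI := T.instFieldFbar; letI := T.instAlgebraFbar
    letI := T.instAlgebraKFbar; letI := T.instIsElliptic
    ∀ (M : Type) [Field M] [NumberField M]
      (archPk : ∀ (j : (thetaIndexOfInitial T.D).Label) (vQ : (thetaIndexOfInitial T.D).VQ),
        Set ((logShellsOfInitialDH T.D (analyticLogvVal T.K)).Packet j vQ))
      (archSub : ∀ (j : (thetaIndexOfInitial T.D).Label) (v : (thetaIndexOfInitial T.D).V),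
        Set ((logShellsOfInitialDH T.D (analyticLogvVal T.K)).Packet j ((thetaIndexOfInitial T.D).over v)))
      (Ψ : ℤ → ∀ v : (thetaIndexOfInitial T.D).V, v ∈ (thetaIndexOfInitial T.D).Vbad →
        Set ((logShellsOfInitialDH T.D (analyticLogvVal T.K)).StarPacket v))
      (act : ℤ → ∀ v : (thetaIndexOfInitial T.D).V, v ∈ (thetaIndexOfInitial T.D).Vbad →
        (logShellsOfInitialDH T.D (analyticLogvVal T.K)).StarPacket v →
          Module.End ℚ ((logShellsOfInitialDH T.D (analyticLogvVal T.K)).StarPacket v))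
      (Mmod : ℤ → ∀ j : (thetaIndexOfInitial T.D).LabelStar, Set ((logShellsOfInitialDH T.D (analyticLogvVal T.K)).GlobalPacket j.1))
      (region : ℤ → ∀ j : (thetaIndexOfInitial T.D).LabelStar, FinDivisor M → ∀ vQ : (thetaIndexOfInitial T.D).VQ,
        Set ((logShellsOfInitialDH T.D (analyticLogvVal T.K)).Packet j.1 vQ))
      (frobAdm : ℤ → ℤ → ∀ (j : (thetaIndexOfInitial T.D).Label) (vQ : (thetaIndexOfInitial T.D).VQ),
        Set ((logShellsOfInitialDH T.D (analyticLogvVal T.K)).Packet j vQ) → Prop)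
      (frobLogvol : ℤ → ℤ → ∀ (j : (thetaIndexOfInitial T.D).Label) (vQ : (thetaIndexOfInitial T.D).VQ),
        Set ((logShellsOfInitialDH T.D (analyticLogvVal T.K)).Packet j vQ) → ℝ)
      (frobΨ : ℤ → ℤ → ∀ v : (thetaIndexOfInitial T.D).V, v ∈ (thetaIndexOfInitial T.D).Vbad →
        Set ((logShellsOfInitialDH T.D (analyticLogvVal T.K)).StarPacket v))
      (frobMmod : ℤ → ℤ → ∀ j : (thetaIndexOfInitial T.D).LabelStar, Set ((logShellsOfInitialDH T.D (analyticLogvVal T.K)).GlobalPacket j.1))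
      (unitImage : ℤ → ℤ → ℕ → ∀ (j : (thetaIndexOfInitial T.D).Label) (vQ : (thetaIndexOfInitial T.D).VQ),
        Set ((logShellsOfInitialDH T.D (analyticLogvVal T.K)).Packet j vQ))
      (ballImage : ℤ → ℤ → ∀ (j : (thetaIndexOfInitial T.D).Label) (vQ : (thetaIndexOfInitial T.D).VQ),
        Set ((logShellsOfInitialDH T.D (analyticLogvVal T.K)).Packet j vQ))
      (thetaDiv : ℤ → ℤ → LgpDivisor M (thetaIndexOfInitial T.D).lstar)
      (n : ℤ) {HT : Type} {LogLink : HT → HT → Type} {IsFull : ∀ {s t : HT}, LogLink s t → Prop}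
      (lat : LGPGaussianLogThetaLattice LogLink IsFull)
      {Frd : Type} {IsoF : Frd → Frd → Type} {Ob : Frd → Type} {realify : Frd → Frd} {Strip : Type}
      {IsoS : Strip → Strip → Type} {Mv : ∀ v : (thetaIndexOfInitial T.D).V, v ∈ (thetaIndexOfInitial T.D).Vbad → Type}
      [∀ v h, Monoid (Mv v h)]
      (sig : GlobalLGPFrobenioidSignature (thetaIndexOfInitial T.D).lstar (thetaIndexOfInitial T.D).V
        (· ∈ (thetaIndexOfInitial T.D).Vbad) Frd IsoF Ob realify Strip IsoS Mv)
      (split : SplittingMonoids Mv) {ObΔ : Type} {N : ∀ v : (thetaIndexOfInitial T.D).V, v ∈ (thetaIndexOfInitial T.D).Vbad → Type}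
      [∀ v h, Monoid (N v h)] (qData : QPilotData ObΔ N)
      (qK : ∀ v : (thetaIndexOfInitial T.D).V, v ∈ (thetaIndexOfInitial T.D).Vbad →
        Set ((logShellsOfInitialDH T.D (analyticLogvVal T.K)).StarPacket v)),
      ¬ Cor312Vol.PilotKummerCompatHull
        (LatticeSituation.ofShells (logShellsOfInitialDH T.D (analyticLogvVal T.K)) M archPk archSub
          (summandPiecesPrM T.D (logvAnalyticVal_analyticLogvVal (K := T.K))).Adm (summandPiecesPrM T.D (logvAnalyticVal_analyticLogvVal (K := T.K))).logvol Ψ act Mmod region frobAdm frobLogvol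
          frobΨ frobMmod unitImage ballImage thetaDiv)
        (settingPrVolSharpM T.D (logvAnalyticVal_analyticLogvVal (K := T.K)) (tOfIdeleData T.D (ideleDataOf T.D T.isVolumeInputOf))
          (fun u x => tqM T.D (ratChar u) u (natCast_ratChar_mem u) (ideleDataOf T.D T.isVolumeInputOf) x) M archPk archSub Ψ act Mmod region n lat sig split qData
          (fun u x => tqM_ne_zero T.D (ratChar u) u (natCast_ratChar_mem u) (ideleDataOf T.D T.isVolumeInputOf) x)
          (GenuineM.finite_ratPlaces_under_S T.D).toFinset
          (fun u x hu => norm_tqM_eq_one_of_not_mem T.D (ratChar u) u (natCast_ratChar_mem u) (ideleDataOf T.D T.isVolumeInputOf) x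
            fun hx => hu ((Set.Finite.mem_toFinset _).mpr ⟨x, hx⟩)))
        (fun _ => Cor312.Setting.qRegion
          (settingPrVolSharpM T.D (logvAnalyticVal_analyticLogvVal (K := T.K)) (tOfIdeleData T.D (ideleDataOf T.D T.isVolumeInputOf))
          (fun u x => tqM T.D (ratChar u) u (natCast_ratChar_mem u) (ideleDataOf T.D T.isVolumeInputOf) x) M archPk archSub Ψ act Mmod region n lat sig split qData
          (fun u x => tqM_ne_zero T.D (ratChar u) u (natCast_ratChar_mem u) (ideleDataOf T.D T.isVolumeInputOf) x)
          (GenuineM.finite_ratPlaces_under_S T.D).toFinset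
          (fun u x hu => norm_tqM_eq_one_of_not_mem T.D (ratChar u) u (natCast_ratChar_mem u) (ideleDataOf T.D T.isVolumeInputOf) x
            fun hx => hu ((Set.Finite.mem_toFinset _).mpr ⟨x, hx⟩)))) qK := by
  letI := T.instFieldF; letI := T.instNumberFieldF; letI := T.instAlgebraF; letI := T.instFieldK
  letI := T.instNumberFieldK; letI := T.instAlgebraK; letI := T.instFieldFbar; letI := T.instAlgebraFbar
  letI := T.instAlgebraKFbar; letI := T.instIsElliptic
  have hp : Nat.Prime 67 := by norm_num
  have hodd : l % 2 = 1 := by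
    rcases hl.eq_two_or_odd with h | h
    · omega
    · exact h
  intro M _ _ archPk archSub Ψ act Mmod region frobAdm frobLogvol frobΨ frobMmod
    unitImage ballImage thetaDiv n HT LogLink IsFull lat Frd IsoF Ob realify Strip IsoS Mv _ sig split ObΔ N _ qData qK
  exact GenuineM.not_pilotKummerCompatHull_triple_of_hullCells_tameSharp isABCTriple_frey31117999167337103924704 T (placeOfPrimeQ 67 (by norm_num)) 67 (ratChar_placeOfPrimeQ 67 (by norm_num)) (by norm_num)
    (by norm_num) (by norm_num) (fun h => h67 h.symm) (by show (67 : ℕ) ∣ _; norm_num)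
    WRow.factorization_frey31117999167337103924704_sixtySeven (i := (l - 1) / 2 - 1) (by omega)
    (fun A h30 h15 hev _ _ => by
      obtain rfl : A = 15 := WRow.refBandClass_sixtySeven_eight h30 h15 hev
      exact WRow.refBandCells_frey31117999167337103924704_sixtySeven l h5 hhi hodd) M archPk archSub Ψ act Mmod region
    frobAdm frobLogvol frobΨ frobMmod unitImage ballImage thetaDiv n lat sig split qData qK

end Summit.ABC.IUTFork.Conditional

end
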